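import Mathlib.Analysis.Convex.Jensen
import Mathlib.Data.Real.Pointwise
import Literature.MathematicalPhysics.QuantumLattice.HubbardNNNHoppingTPrimeChordBounds
import Literature.MathematicalPhysics.QuantumLattice.HubbardEnergyDensityChordBounds
import Literature.MathematicalPhysics.QuantumLattice.HubbardTTPrimeHartreeFockCeiling
import Literature.MathematicalPhysics.QuantumLattice.HubbardNNNHoppingEnergyDensityMonotone
import HarnessLib

/-!
# Region (box / simplex / line) bounds for the `t–t'` Hubbard ground-state energy density from
# certified bounds at anchor points: joint concavity in the couplings, Lipschitz constants in
# `t'` and `U`, outward extrapolation in the density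

Family `hubbard` (topic `MathematicalPhysics/QuantumLattice`); written for the certified
"fast layer" of the Hubbard re-charter (D-0042 R1b: certify parameter REGIONS between certified
anchor points without a new certificate). The object is the tree's thermodynamic-limit energy
density `e(t, t', U, n) = energyDensityTT' t t' U n` of
`H(t,t',U) = -t T - t' T' + U D` (`hubbardRectTorusTT'`; LeBlanc et al. (2015) eq. (1)). Everything
below is a consequence of three structural facts that are already in the tree — the Hamiltonian is
LINEAR in the coupling vector `(t, t', U)` (`hubbardRectTorusTT'_convexComb`), the energy density is
CONVEX in the density (`convexOn_energyDensityTT'`), and the paramagnetic Hartree–Fock ceiling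
`e(t,t',U,n) ≤ e(t,t',0,n) + U (n/2)²` (`energyDensityTT'_le_free_add_interaction`) — read the way a
region-certification engine consumes them:

* §1 `groundEnergy_hubbardRectTorusTT'_add_ge`, `energyDensityTT'_add_ge` — SUPERADDITIVITY in the
  couplings (finite volume and thermodynamic limit): `e(t₁+t₂, t'₁+t'₂, U₁+U₂, n) ≥ e(t₁,t'₁,U₁,n) +
  e(t₂,t'₂,U₂,n)` (the ground state of the sum is a trial state for each summand);
  `concaveOn_energyDensityTT'_couplings` — JOINT concavity of `(t, t', U) ↦ e` on the half-space
  `U ≥ 0` (the tree had the finite-volume joint statement `concaveOn_groundEnergy_hubbardRectTorusTT'`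
  and the two one-parameter limits `concaveOn_energyDensityTT'_U` / `_tPrime` only);
  `concaveOn_energyDensityTT'_tPrime_U` — the `(t', U)` half-plane at fixed `t`.
* §2 `energyDensityTT'_ge_sum_lowerBounds` — BARYCENTRIC (Jensen) lower bounds: certified lower
  bounds `lo i ≤ e(t, t'ᵢ, Uᵢ, n)` at finitely many anchors and convex weights `w` give
  `Σ wᵢ loᵢ ≤ e(t, Σ wᵢ t'ᵢ, Σ wᵢ Uᵢ, n)`: every point of the convex hull of the anchors is certified
  from below (triangles: `energyDensityTT'_triangle_ge`, `energyDensityTT'_triangle_ge_at`; the `(U, t')`-ordered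
  concavity `concaveOn_energyDensityTT'_U_tPrime` on `Ici 0 ×ˢ univ` is the shape asked for by the crew's run-book);
  `energyDensityTT'_box_ge`, `energyDensityTT'_box_ge_min` — the
  rectangle `[s₁,s₂] × [U₁,U₂]`: the bilinear interpolant of the four corner lower bounds, and their
  minimum, bound `e` from below on the whole closed box.
* §3 `energyDensityTT'_le_extrapolate_line` — outward UPPER bounds along any ray of the `(t',U)`
  half-plane: `L₁ ≤ e(p₁)`, `e(p₂) ≤ R₂`, `p₃ = p₂ + θ(p₂ - p₁)`, `θ ≥ 0` give
  `e(p₃) ≤ R₂ + θ(R₂ - L₁)` (the two axis-parallel cases are the tree's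
  `energyDensityTT'_le_extrapolate` and `energyDensityTT'_tPrime_le_extrapolate_right/left`).
* §4 LIPSCHITZ constants where no second anchor exists: `energyDensityTT'_diag_free_ge` — the free
  diagonal band costs at most `4|t'|` per particle, `e(0, t', 0, n) ≥ -4|t'| n` (Lieb–Loss bathtub,
  `TTPrimeFree.le_groundEnergy_hubbardTorusTT'` at `μ = -4|t'|`); hence
  `energyDensityTT'_tPrime_lipschitz_ge` / `abs_energyDensityTT'_sub_tPrime_le`:
  `|e(t,s,U,n) - e(t,s',U,n)| ≤ 4n|s - s'|` (Israel (1979) Thm I.3.4: the pressure / energy density is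
  `1`-Lipschitz in the interaction norm, here `‖t' T'‖ per site`); and in `U`, from the Hartree–Fock
  ceiling and concavity, `energyDensityTT'_ge_sub_mul_sq_U` / `abs_energyDensityTT'_sub_U_le`:
  `0 ≤ e(t,s,U,n) - e(t,s,U',n) ≤ (U - U')(n/2)²` for `0 ≤ U' ≤ U` (the double-occupancy DENSITY of
  the interacting ground state never exceeds the free value `(n/2)²`).
* §6 `groundEnergy_hubbardRectTorusTT'_smul`, `energyDensityTT'_smul`, `energyDensityTT'_eq_mul_unit` —
  positive HOMOGENEITY in the coupling vector (`e(ct,ct',cU,n) = c·e(t,t',U,n)`, `c ≥ 0`; `t ≡ 1` is no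
  loss — planner-p1 TARGET §6 T5).
* §5 `energyDensityTT'_ge_density_extrapolate_right/left` — outward LOWER bounds in the density from
  convexity: an upper bound `e(n₀) ≤ R₀` and a lower bound `L₁ ≤ e(n₁)` give, beyond `n₁` (on the far
  side from `n₀`), `e(n) ≥ L₁ + (L₁ - R₀)(n - n₁)/(n₁ - n₀)` (the density twin of §3; between two
  anchors convexity gives the UPPER chord `energyDensityTT'_le_density_chord`).

How a region engine uses this file (no new certificate is solved anywhere): inside the convex hull of
anchors with certified LOWER bounds use §2; UPPER bounds at a non-anchor point come from §3 along the
ray through two anchors (or from any trial state); outside the anchor hull use §4 (`t'`) and the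
tree's monotonicity `energyDensityTT'_mono_U` / §4 (`U`); in the density use §5 and the chord. The
resulting two-sided window at the target point is the energy input of the correlator certificates
(`HubbardNNNHoppingCorrelatorWindowCertificate`). Everything is PROVED; no definition, no named fact,
no numerical input.

## Mathlib / tree search

REUSED: `hubbardRectTorusTT'_convexComb`, `concaveOn_groundEnergy_hubbardRectTorusTT'`,
`tendsto_energyDensityTT'`, `tendsto_energyDensityTT'_torus`, `convexOn_energyDensityTT'`,
`energyDensityTT'_chord_le`, `energyDensityTT'_mono_U`,
`TTPrimeFree.le_groundEnergy_hubbardTorusTT'`, `TTPrimeFree.energyDensityTT'_le_free_add_interaction`,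
`groundEnergy_hubbardTorusTT'_eq_rect`, `LiebThm1.groundEnergy_le_re_expect`, `rectN_le`,
`rectN_le_two_mul`, `tendsto_rectN_div_sq`; Mathlib `ConcaveOn.le_map_sum`, `Prod.fst_sum`,
`Prod.snd_sum`, `le_of_tendsto_of_tendsto'`. `lean search 'concaveOn_energyDensityTT.|lipschitz.*energyDensity|
box_ge|le_map_sum' in Literature/MathematicalPhysics`: only the one-parameter statements listed above.

## References

* R. B. Israel, *Convexity in the Theory of Lattice Gases*, Princeton (1979), Thm. I.3.4 (quantum
  lattice systems: the pressure is convex on the Banach space of interactions and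
  `|P(Φ) - P(Ψ)| ≤ ‖Φ - Ψ‖`; its `β → ∞` shadow is the concavity and interaction-norm Lipschitz
  continuity of the ground-state energy density used here). [cite: Israel1979, Thm. I.3.4]
* D. Ruelle, *Statistical Mechanics: Rigorous Results* (1969), §3.3–§3.4 (thermodynamic limit of
  the ground-state energy density; convexity in the density, concavity in linear parameters).
  [cite: Ruelle1969, §3.3]
* T. Koma, H. Tasaki, J. Stat. Phys. 76 (1994) 745, §1 (ground-state energy concave in a coupling
  constant multiplying a term of the Hamiltonian). [cite: KomaTasaki1994, §1]
* E. H. Lieb, M. Loss, Duke Math. J. 71 (1993) 337, §8 Thm. 8.2 (the sum of the lowest one-body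
  levels bounds a free-fermion energy from below). [cite: LiebLoss1993, §8, Theorem 8.2]
* V. Bach, E. H. Lieb, J. P. Solovej, J. Stat. Phys. 76 (1994) 3, eq. (2c.36) (Hartree–Fock
  states are variational). [cite: BachLiebSolovej1994, eq. (2c.36)]
* J. P. F. LeBlanc et al., Phys. Rev. X 5 (2015) 041041, eq. (1) (the `t–t'–U` family).
  [cite: LeBlancEtAl2015, eq. (1)]
-/

noncomputable section

open Matrix Finset Filter Topology Set

namespace Literature.MathematicalPhysics.QuantumLattice

namespace ThermodynamicLimit

/-! ### §1 Superadditivity and joint concavity in the couplings -/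

/-- `⟨ψ, (A + B)ψ⟩ = ⟨ψ, Aψ⟩ + ⟨ψ, Bψ⟩`. [folklore] -/
private theorem expect_add' {ι : Type*} [Fintype ι] (A B : Matrix (Finset ι) (Finset ι) ℂ)
    (ψ : Fock ι) : expect (A + B) ψ = expect A ψ + expect B ψ := by
  simp [expect, add_mulVec, dotProduct_add]

/-- **The `t–t'` Hamiltonian is additive in the coupling vector**:
`H(t₁+t₂, t'₁+t'₂, U₁+U₂) = H(t₁,t'₁,U₁) + H(t₂,t'₂,U₂)`. [cite: LeBlancEtAl2015, eq. (1)] -/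
theorem hubbardRectTorusTT'_add (a b : ℕ) (t₁ t₂ t'₁ t'₂ U₁ U₂ : ℝ) :
    hubbardRectTorusTT' a b (t₁ + t₂) (t'₁ + t'₂) (U₁ + U₂) =
      hubbardRectTorusTT' a b t₁ t'₁ U₁ + hubbardRectTorusTT' a b t₂ t'₂ U₂ := by
  have h := hubbardRectTorusTT'_convexComb a b 1 1 t₁ t₂ t'₁ t'₂ U₁ U₂
  simp only [one_mul, Complex.ofReal_one, one_smul] at h
  exact h

/-- **Superadditivity of the sector ground-state energies in the couplings** (finite volume): on
every rectangular torus and in every particle-number sector,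
`E_N(t₁,t'₁,U₁) + E_N(t₂,t'₂,U₂) ≤ E_N(t₁+t₂, t'₁+t'₂, U₁+U₂)` — a normalised trial state for the sum is
one for each summand (empty sector: all three values are the junk `0`). [cite: KomaTasaki1994, §1] -/
theorem groundEnergy_hubbardRectTorusTT'_add_ge (a b N : ℕ) (t₁ t₂ t'₁ t'₂ U₁ U₂ : ℝ) :
    groundEnergy (hubbardRectTorusTT' a b t₁ t'₁ U₁) N +
        groundEnergy (hubbardRectTorusTT' a b t₂ t'₂ U₂) N ≤
      groundEnergy (hubbardRectTorusTT' a b (t₁ + t₂) (t'₁ + t'₂) (U₁ + U₂)) N := by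
  by_cases hne : ∃ ψ : Fock (Orb (Fin a ×ₗ Fin b)), IsNParticle N ψ ∧ star ψ ⬝ᵥ ψ = 1
  · obtain ⟨ψ₀, hN₀, h₀⟩ := hne
    have hS : groundEnergy (hubbardRectTorusTT' a b (t₁ + t₂) (t'₁ + t'₂) (U₁ + U₂)) N =
        sInf {E : ℝ | ∃ ψ : Fock (Orb (Fin a ×ₗ Fin b)), IsNParticle N ψ ∧ star ψ ⬝ᵥ ψ = 1 ∧
          E = (expect (hubbardRectTorusTT' a b (t₁ + t₂) (t'₁ + t'₂) (U₁ + U₂)) ψ).re} := rfl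
    rw [hS]
    refine le_csInf ⟨_, ψ₀, hN₀, h₀, rfl⟩ ?_
    rintro E ⟨ψ, hN, h1, rfl⟩
    have hx := LiebThm1.groundEnergy_le_re_expect (hubbardRectTorusTT' a b t₁ t'₁ U₁) hN h1
    have hy := LiebThm1.groundEnergy_le_re_expect (hubbardRectTorusTT' a b t₂ t'₂ U₂) hN h1
    rw [hubbardRectTorusTT'_add, expect_add', Complex.add_re]
    exact add_le_add hx hy
  · -- empty sector: all values are the junk value `sInf ∅ = 0`
    have h0 : ∀ t t' U : ℝ, groundEnergy (hubbardRectTorusTT' a b t t' U) N = 0 := by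
      intro t t' U
      have hS : {E : ℝ | ∃ ψ : Fock (Orb (Fin a ×ₗ Fin b)), IsNParticle N ψ ∧ star ψ ⬝ᵥ ψ = 1 ∧
          E = (expect (hubbardRectTorusTT' a b t t' U) ψ).re} = ∅ :=
        Set.eq_empty_iff_forall_notMem.2 (by
          rintro E ⟨ψ, hN, h1, -⟩
          exact hne ⟨ψ, hN, h1⟩)
      show sInf _ = 0
      rw [hS, Real.sInf_empty]
    simp [h0]

/-- **Superadditivity in the thermodynamic limit**: for `U₁, U₂ ≥ 0`, `0 ≤ n < 2`,
`e(t₁,t'₁,U₁,n) + e(t₂,t'₂,U₂,n) ≤ e(t₁+t₂, t'₁+t'₂, U₁+U₂, n)`. [cite: Ruelle1969, §3.3] -/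
theorem energyDensityTT'_add_ge (t₁ t₂ t'₁ t'₂ : ℝ) {U₁ U₂ : ℝ} (hU₁ : 0 ≤ U₁) (hU₂ : 0 ≤ U₂)
    {n : ℝ} (hn0 : 0 ≤ n) (hn2 : n < 2) :
    energyDensityTT' t₁ t'₁ U₁ n + energyDensityTT' t₂ t'₂ U₂ n ≤
      energyDensityTT' (t₁ + t₂) (t'₁ + t'₂) (U₁ + U₂) n := by
  have l1 := tendsto_energyDensityTT' t₁ t'₁ hU₁ hn0 hn2
  have l2 := tendsto_energyDensityTT' t₂ t'₂ hU₂ hn0 hn2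
  have l3 := tendsto_energyDensityTT' (t₁ + t₂) (t'₁ + t'₂) (add_nonneg hU₁ hU₂) hn0 hn2
  refine le_of_tendsto_of_tendsto' (l1.add l2) l3 fun L => ?_
  have hL2 : (0 : ℝ) ≤ (L : ℝ) ^ 2 := sq_nonneg _
  calc groundEnergy (hubbardRectTorusTT' L L t₁ t'₁ U₁) (rectN n L) / (L : ℝ) ^ 2 +
        groundEnergy (hubbardRectTorusTT' L L t₂ t'₂ U₂) (rectN n L) / (L : ℝ) ^ 2
      = (groundEnergy (hubbardRectTorusTT' L L t₁ t'₁ U₁) (rectN n L) +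
          groundEnergy (hubbardRectTorusTT' L L t₂ t'₂ U₂) (rectN n L)) / (L : ℝ) ^ 2 := by ring
    _ ≤ groundEnergy (hubbardRectTorusTT' L L (t₁ + t₂) (t'₁ + t'₂) (U₁ + U₂)) (rectN n L) /
          (L : ℝ) ^ 2 :=
        div_le_div_of_nonneg_right (groundEnergy_hubbardRectTorusTT'_add_ge L L (rectN n L)
          t₁ t₂ t'₁ t'₂ U₁ U₂) hL2

/-- **Joint concavity of the energy density in the couplings `(t, t', U)`** on the half-space
`U ≥ 0` (where the defining limit exists): for `0 ≤ n < 2` the map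
`(t, t', U) ↦ e(t, t', U, n)` is concave on `{U ≥ 0} ⊆ ℝ³` — the pointwise limit of the jointly
concave finite-volume energies per site `concaveOn_groundEnergy_hubbardRectTorusTT'`.
[cite: Israel1979, Thm. I.3.4] [cite: Ruelle1969, §3.3] -/
theorem concaveOn_energyDensityTT'_couplings {n : ℝ} (hn0 : 0 ≤ n) (hn2 : n < 2) :
    ConcaveOn ℝ {v : ℝ × ℝ × ℝ | 0 ≤ v.2.2} (fun v => energyDensityTT' v.1 v.2.1 v.2.2 n) := by
  refine ⟨?_, fun x hx y hy p q hp hq hpq => ?_⟩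
  · intro x hx y hy p q hp hq _
    simp only [mem_setOf_eq, Prod.snd_add, Prod.smul_snd, smul_eq_mul] at hx hy ⊢
    exact add_nonneg (mul_nonneg hp hx) (mul_nonneg hq hy)
  simp only [mem_setOf_eq] at hx hy
  simp only [smul_eq_mul, Prod.smul_fst, Prod.smul_snd, Prod.fst_add, Prod.snd_add]
  have hz : 0 ≤ p * x.2.2 + q * y.2.2 := add_nonneg (mul_nonneg hp hx) (mul_nonneg hq hy)
  have limx := tendsto_energyDensityTT' x.1 x.2.1 hx hn0 hn2
  have limy := tendsto_energyDensityTT' y.1 y.2.1 hy hn0 hn2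
  have limz := tendsto_energyDensityTT' (p * x.1 + q * y.1) (p * x.2.1 + q * y.2.1) hz hn0 hn2
  refine le_of_tendsto_of_tendsto' ((limx.const_mul p).add (limy.const_mul q)) limz fun L => ?_
  have hL := (concaveOn_groundEnergy_hubbardRectTorusTT' L L (rectN n L)).2 (mem_univ x)
    (mem_univ y) hp hq hpq
  simp only [smul_eq_mul, Prod.smul_fst, Prod.smul_snd, Prod.fst_add, Prod.snd_add] at hL
  have hL2 : (0 : ℝ) ≤ (L : ℝ) ^ 2 := sq_nonneg _
  calc p * (groundEnergy (hubbardRectTorusTT' L L x.1 x.2.1 x.2.2) (rectN n L) / (L : ℝ) ^ 2) +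
        q * (groundEnergy (hubbardRectTorusTT' L L y.1 y.2.1 y.2.2) (rectN n L) / (L : ℝ) ^ 2)
      = (p * groundEnergy (hubbardRectTorusTT' L L x.1 x.2.1 x.2.2) (rectN n L) +
          q * groundEnergy (hubbardRectTorusTT' L L y.1 y.2.1 y.2.2) (rectN n L)) /
            (L : ℝ) ^ 2 := by ring
    _ ≤ groundEnergy (hubbardRectTorusTT' L L (p * x.1 + q * y.1) (p * x.2.1 + q * y.2.1)
          (p * x.2.2 + q * y.2.2)) (rectN n L) / (L : ℝ) ^ 2 :=
        div_le_div_of_nonneg_right hL hL2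

/-- **Joint concavity in `(t', U)` at fixed `t`** on the half-plane `U ≥ 0`: for `0 ≤ n < 2` the map
`(t', U) ↦ e(t, t', U, n)` is concave on `{U ≥ 0} ⊆ ℝ²`. [cite: Israel1979, Thm. I.3.4] -/
theorem concaveOn_energyDensityTT'_tPrime_U (t : ℝ) {n : ℝ} (hn0 : 0 ≤ n) (hn2 : n < 2) :
    ConcaveOn ℝ {p : ℝ × ℝ | 0 ≤ p.2} (fun p => energyDensityTT' t p.1 p.2 n) := by
  refine ⟨?_, fun x hx y hy a b ha hb hab => ?_⟩
  · intro x hx y hy a b ha hb _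
    simp only [mem_setOf_eq, Prod.snd_add, Prod.smul_snd, smul_eq_mul] at hx hy ⊢
    exact add_nonneg (mul_nonneg ha hx) (mul_nonneg hb hy)
  simp only [mem_setOf_eq] at hx hy
  have hx' : ((t, x.1, x.2) : ℝ × ℝ × ℝ) ∈ {v : ℝ × ℝ × ℝ | 0 ≤ v.2.2} := hx
  have hy' : ((t, y.1, y.2) : ℝ × ℝ × ℝ) ∈ {v : ℝ × ℝ × ℝ | 0 ≤ v.2.2} := hy
  have h := (concaveOn_energyDensityTT'_couplings hn0 hn2).2 hx' hy' ha hb hab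
  simp only [smul_eq_mul, Prod.smul_mk, Prod.mk_add_mk, Prod.smul_fst, Prod.smul_snd,
    Prod.fst_add, Prod.snd_add] at h ⊢
  have ht : a * t + b * t = t := by rw [← add_mul, hab, one_mul]
  rwa [ht] at h

/-! ### §2 Barycentric and box lower bounds from anchor lower bounds -/

/-- **Barycentric (Jensen) lower bound.** Certified lower bounds `lo i ≤ e(t, t'ᵢ, Uᵢ, n)` at
finitely many anchors `(t'ᵢ, Uᵢ)` with `Uᵢ ≥ 0`, and convex weights `wᵢ ≥ 0`, `Σ wᵢ = 1`, give
`Σ wᵢ loᵢ ≤ e(t, Σ wᵢ t'ᵢ, Σ wᵢ Uᵢ, n)`: every point of the convex hull of the anchors is certified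
from below, by the weighted mean of the anchor bounds. [cite: Israel1979, Thm. I.3.4] -/
theorem energyDensityTT'_ge_sum_lowerBounds (t : ℝ) {n : ℝ} (hn0 : 0 ≤ n) (hn2 : n < 2)
    {ι : Type*} (s : Finset ι) (w tp U lo : ι → ℝ) (hw : ∀ i ∈ s, 0 ≤ w i)
    (hw1 : ∑ i ∈ s, w i = 1) (hU : ∀ i ∈ s, 0 ≤ U i)
    (hlo : ∀ i ∈ s, lo i ≤ energyDensityTT' t (tp i) (U i) n) :
    ∑ i ∈ s, w i * lo i ≤
      energyDensityTT' t (∑ i ∈ s, w i * tp i) (∑ i ∈ s, w i * U i) n := by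
  have hJ := (concaveOn_energyDensityTT'_tPrime_U t hn0 hn2).le_map_sum (t := s) (w := w)
    (p := fun i => (tp i, U i)) hw hw1 (fun i hi => hU i hi)
  simp only [smul_eq_mul, Prod.fst_sum, Prod.snd_sum, Prod.smul_mk] at hJ
  calc ∑ i ∈ s, w i * lo i ≤ ∑ i ∈ s, w i * energyDensityTT' t (tp i) (U i) n :=
        Finset.sum_le_sum fun i hi => mul_le_mul_of_nonneg_left (hlo i hi) (hw i hi)
    _ ≤ _ := hJ

/-- Two-point form of the barycentric bound (a segment of the `(t', U)` half-plane): for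
`U₁, U₂ ≥ 0`, weights `a, b ≥ 0`, `a + b = 1`, and lower bounds `L₁ ≤ e(t,s₁,U₁,n)`,
`L₂ ≤ e(t,s₂,U₂,n)`: `a L₁ + b L₂ ≤ e(t, a s₁ + b s₂, a U₁ + b U₂, n)`. [cite: Israel1979, Thm. I.3.4] -/
theorem energyDensityTT'_ge_convexComb (t : ℝ) {n : ℝ} (hn0 : 0 ≤ n) (hn2 : n < 2)
    {s₁ s₂ U₁ U₂ a b L₁ L₂ : ℝ} (hU₁ : 0 ≤ U₁) (hU₂ : 0 ≤ U₂) (ha : 0 ≤ a) (hb : 0 ≤ b)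
    (hab : a + b = 1) (hL₁ : L₁ ≤ energyDensityTT' t s₁ U₁ n)
    (hL₂ : L₂ ≤ energyDensityTT' t s₂ U₂ n) :
    a * L₁ + b * L₂ ≤ energyDensityTT' t (a * s₁ + b * s₂) (a * U₁ + b * U₂) n := by
  have hx : ((s₁, U₁) : ℝ × ℝ) ∈ {p : ℝ × ℝ | 0 ≤ p.2} := hU₁
  have hy : ((s₂, U₂) : ℝ × ℝ) ∈ {p : ℝ × ℝ | 0 ≤ p.2} := hU₂
  have h := (concaveOn_energyDensityTT'_tPrime_U t hn0 hn2).2 hx hy ha hb hab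
  simp only [smul_eq_mul, Prod.smul_mk, Prod.mk_add_mk] at h
  have h1 := mul_le_mul_of_nonneg_left hL₁ ha
  have h2 := mul_le_mul_of_nonneg_left hL₂ hb
  linarith

/-- **Box lower bound (bilinear interpolation of the corner bounds).** For a rectangle
`[s₁, s₂] × [U₁, U₂]` of the `(t', U)` half-plane (`0 ≤ U₁`, `s₁ < s₂`, `U₁ < U₂`) and certified
lower bounds at its four corners, `L₁₁ ≤ e(s₁,U₁)`, `L₁₂ ≤ e(s₁,U₂)`, `L₂₁ ≤ e(s₂,U₁)`,
`L₂₂ ≤ e(s₂,U₂)`, every point `(s, U)` of the CLOSED box satisfies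
`[(s₂-s)((U₂-U)L₁₁ + (U-U₁)L₁₂) + (s-s₁)((U₂-U)L₂₁ + (U-U₁)L₂₂)] / ((s₂-s₁)(U₂-U₁)) ≤ e(t,s,U,n)`
(concavity along `U` on the two vertical edges, then along `t'`). [cite: Israel1979, Thm. I.3.4] -/
theorem energyDensityTT'_box_ge (t : ℝ) {n : ℝ} (hn0 : 0 ≤ n) (hn2 : n < 2)
    {s₁ s₂ U₁ U₂ s U L₁₁ L₁₂ L₂₁ L₂₂ : ℝ} (hU₁ : 0 ≤ U₁) (hs : s₁ < s₂) (hU : U₁ < U₂)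
    (hs₁ : s₁ ≤ s) (hs₂ : s ≤ s₂) (hU₁' : U₁ ≤ U) (hU₂ : U ≤ U₂)
    (h₁₁ : L₁₁ ≤ energyDensityTT' t s₁ U₁ n) (h₁₂ : L₁₂ ≤ energyDensityTT' t s₁ U₂ n)
    (h₂₁ : L₂₁ ≤ energyDensityTT' t s₂ U₁ n) (h₂₂ : L₂₂ ≤ energyDensityTT' t s₂ U₂ n) :
    ((s₂ - s) * ((U₂ - U) * L₁₁ + (U - U₁) * L₁₂) +
        (s - s₁) * ((U₂ - U) * L₂₁ + (U - U₁) * L₂₂)) / ((s₂ - s₁) * (U₂ - U₁)) ≤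
      energyDensityTT' t s U n := by
  have hdU : 0 < U₂ - U₁ := by linarith
  have hds : 0 < s₂ - s₁ := by linarith
  have hU₂0 : 0 ≤ U₂ := by linarith
  -- weights along `U`
  set α : ℝ := (U₂ - U) / (U₂ - U₁) with hα'
  set α' : ℝ := (U - U₁) / (U₂ - U₁) with hα''
  have hα0 : 0 ≤ α := div_nonneg (by linarith) hdU.le
  have hα'0 : 0 ≤ α' := div_nonneg (by linarith) hdU.le
  have hαα : α + α' = 1 := by
    rw [hα', hα'', ← add_div, div_eq_one_iff_eq hdU.ne']
    ring
  have hUcomb : α * U₁ + α' * U₂ = U := by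
    rw [hα', hα'']
    field_simp
    ring
  -- the two vertical edges
  have e₁ : α * L₁₁ + α' * L₁₂ ≤ energyDensityTT' t s₁ U n := by
    have h := energyDensityTT'_ge_convexComb t hn0 hn2 hU₁ hU₂0 hα0 hα'0 hαα h₁₁ h₁₂
    rwa [hUcomb, show α * s₁ + α' * s₁ = s₁ by rw [← add_mul, hαα, one_mul]] at h
  have e₂ : α * L₂₁ + α' * L₂₂ ≤ energyDensityTT' t s₂ U n := by
    have h := energyDensityTT'_ge_convexComb t hn0 hn2 hU₁ hU₂0 hα0 hα'0 hαα h₂₁ h₂₂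
    rwa [hUcomb, show α * s₂ + α' * s₂ = s₂ by rw [← add_mul, hαα, one_mul]] at h
  -- weights along `t'`
  set β : ℝ := (s₂ - s) / (s₂ - s₁) with hβ'
  set β' : ℝ := (s - s₁) / (s₂ - s₁) with hβ''
  have hβ0 : 0 ≤ β := div_nonneg (by linarith) hds.le
  have hβ'0 : 0 ≤ β' := div_nonneg (by linarith) hds.le
  have hββ : β + β' = 1 := by
    rw [hβ', hβ'', ← add_div, div_eq_one_iff_eq hds.ne']
    ring
  have hscomb : β * s₁ + β' * s₂ = s := by
    rw [hβ', hβ'']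
    field_simp
    ring
  have hU0 : 0 ≤ U := le_trans hU₁ hU₁'
  have e₃ := energyDensityTT'_ge_convexComb t hn0 hn2 hU0 hU0 hβ0 hβ'0 hββ e₁ e₂
  rw [hscomb, show β * U + β' * U = U by rw [← add_mul, hββ, one_mul]] at e₃
  have key : ((s₂ - s) * ((U₂ - U) * L₁₁ + (U - U₁) * L₁₂) +
      (s - s₁) * ((U₂ - U) * L₂₁ + (U - U₁) * L₂₂)) / ((s₂ - s₁) * (U₂ - U₁)) =
      β * (α * L₁₁ + α' * L₁₂) + β' * (α * L₂₁ + α' * L₂₂) := by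
    rw [hα', hα'', hβ', hβ'']
    field_simp
  rw [key]
  exact e₃

/-- **Box lower bound, min form.** With the data of `energyDensityTT'_box_ge`, the smallest of the
four corner lower bounds is a lower bound on the whole closed box:
`min (min L₁₁ L₁₂) (min L₂₁ L₂₂) ≤ e(t, s, U, n)`. [cite: Israel1979, Thm. I.3.4] -/
theorem energyDensityTT'_box_ge_min (t : ℝ) {n : ℝ} (hn0 : 0 ≤ n) (hn2 : n < 2)
    {s₁ s₂ U₁ U₂ s U L₁₁ L₁₂ L₂₁ L₂₂ : ℝ} (hU₁ : 0 ≤ U₁) (hs : s₁ < s₂) (hU : U₁ < U₂)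
    (hs₁ : s₁ ≤ s) (hs₂ : s ≤ s₂) (hU₁' : U₁ ≤ U) (hU₂ : U ≤ U₂)
    (h₁₁ : L₁₁ ≤ energyDensityTT' t s₁ U₁ n) (h₁₂ : L₁₂ ≤ energyDensityTT' t s₁ U₂ n)
    (h₂₁ : L₂₁ ≤ energyDensityTT' t s₂ U₁ n) (h₂₂ : L₂₂ ≤ energyDensityTT' t s₂ U₂ n) :
    min (min L₁₁ L₁₂) (min L₂₁ L₂₂) ≤ energyDensityTT' t s U n := by
  set m : ℝ := min (min L₁₁ L₁₂) (min L₂₁ L₂₂) with hm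
  have hm₁₁ : m ≤ L₁₁ := (min_le_left _ _).trans (min_le_left _ _)
  have hm₁₂ : m ≤ L₁₂ := (min_le_left _ _).trans (min_le_right _ _)
  have hm₂₁ : m ≤ L₂₁ := (min_le_right _ _).trans (min_le_left _ _)
  have hm₂₂ : m ≤ L₂₂ := (min_le_right _ _).trans (min_le_right _ _)
  have h := energyDensityTT'_box_ge t hn0 hn2 hU₁ hs hU hs₁ hs₂ hU₁' hU₂ (hm₁₁.trans h₁₁)
    (hm₁₂.trans h₁₂) (hm₂₁.trans h₂₁) (hm₂₂.trans h₂₂)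
  have hden : 0 < (s₂ - s₁) * (U₂ - U₁) := mul_pos (by linarith) (by linarith)
  have e : ((s₂ - s) * ((U₂ - U) * m + (U - U₁) * m) + (s - s₁) * ((U₂ - U) * m + (U - U₁) * m)) /
      ((s₂ - s₁) * (U₂ - U₁)) = m := by
    rw [div_eq_iff hden.ne']
    ring
  rwa [e] at h

/-- **Joint concavity, `(U, t')` ordering** — the shape requested by the burst run-book (crew hubbard-fast,
RUN-BOOK §8 L-1): for `0 ≤ n < 2` the map `(U, t') ↦ e(t, t', U, n)` is concave on `Set.Ici 0 ×ˢ Set.univ`.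
[cite: Israel1979, Thm. I.3.4] -/
theorem concaveOn_energyDensityTT'_U_tPrime (t : ℝ) {n : ℝ} (hn0 : 0 ≤ n) (hn2 : n < 2) :
    ConcaveOn ℝ (Ici (0 : ℝ) ×ˢ (univ : Set ℝ)) (fun p : ℝ × ℝ => energyDensityTT' t p.2 p.1 n) := by
  refine ⟨(convex_Ici 0).prod convex_univ, fun x hx y hy a b ha hb hab => ?_⟩
  have hx' : ((x.2, x.1) : ℝ × ℝ) ∈ {p : ℝ × ℝ | 0 ≤ p.2} := Set.mem_Ici.1 (Set.mem_prod.1 hx).1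
  have hy' : ((y.2, y.1) : ℝ × ℝ) ∈ {p : ℝ × ℝ | 0 ≤ p.2} := Set.mem_Ici.1 (Set.mem_prod.1 hy).1
  have h := (concaveOn_energyDensityTT'_tPrime_U t hn0 hn2).2 hx' hy' ha hb hab
  simp only [smul_eq_mul, Prod.smul_mk, Prod.mk_add_mk, Prod.smul_fst, Prod.smul_snd, Prod.fst_add,
    Prod.snd_add] at h ⊢
  exact h

/-- **Triangle lower bound** (three anchors — the barycentric corollary of RUN-BOOK §8 L-1, which lets a
coverage grid be a triangulation): for anchors `(sᵢ, Uᵢ)` of the `(t', U)` half-plane (`Uᵢ ≥ 0`), weights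
`a, b, c ≥ 0` with `a + b + c = 1`, and certified lower bounds `Lᵢ ≤ e(t, sᵢ, Uᵢ, n)`:
`a L₁ + b L₂ + c L₃ ≤ e(t, a s₁ + b s₂ + c s₃, a U₁ + b U₂ + c U₃, n)`. [cite: Israel1979, Thm. I.3.4] -/
theorem energyDensityTT'_triangle_ge (t : ℝ) {n : ℝ} (hn0 : 0 ≤ n) (hn2 : n < 2)
    {s₁ s₂ s₃ U₁ U₂ U₃ a b c L₁ L₂ L₃ : ℝ} (hU₁ : 0 ≤ U₁) (hU₂ : 0 ≤ U₂) (hU₃ : 0 ≤ U₃)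
    (ha : 0 ≤ a) (hb : 0 ≤ b) (hc : 0 ≤ c) (habc : a + b + c = 1)
    (hL₁ : L₁ ≤ energyDensityTT' t s₁ U₁ n) (hL₂ : L₂ ≤ energyDensityTT' t s₂ U₂ n)
    (hL₃ : L₃ ≤ energyDensityTT' t s₃ U₃ n) :
    a * L₁ + b * L₂ + c * L₃ ≤
      energyDensityTT' t (a * s₁ + b * s₂ + c * s₃) (a * U₁ + b * U₂ + c * U₃) n := by
  have h := energyDensityTT'_ge_sum_lowerBounds t hn0 hn2 (Finset.univ : Finset (Fin 3))
    ![a, b, c] ![s₁, s₂, s₃] ![U₁, U₂, U₃] ![L₁, L₂, L₃]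
    (fun i _ => by fin_cases i <;> simp [ha, hb, hc])
    (by simp [Fin.sum_univ_three, habc])
    (fun i _ => by fin_cases i <;> simp [hU₁, hU₂, hU₃])
    (fun i _ => by fin_cases i <;> simp [hL₁, hL₂, hL₃])
  simpa [Fin.sum_univ_three] using h

/-- **Where the barycentric point is prescribed**: the triangle bound read at a target point `(s, U)` that is
written as a convex combination of the three anchors (the engine supplies the weights; all hypotheses are
linear arithmetic). [cite: Israel1979, Thm. I.3.4] -/
theorem energyDensityTT'_triangle_ge_at (t : ℝ) {n : ℝ} (hn0 : 0 ≤ n) (hn2 : n < 2)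
    {s₁ s₂ s₃ U₁ U₂ U₃ a b c L₁ L₂ L₃ s U : ℝ} (hU₁ : 0 ≤ U₁) (hU₂ : 0 ≤ U₂) (hU₃ : 0 ≤ U₃)
    (ha : 0 ≤ a) (hb : 0 ≤ b) (hc : 0 ≤ c) (habc : a + b + c = 1)
    (hs : a * s₁ + b * s₂ + c * s₃ = s) (hU : a * U₁ + b * U₂ + c * U₃ = U)
    (hL₁ : L₁ ≤ energyDensityTT' t s₁ U₁ n) (hL₂ : L₂ ≤ energyDensityTT' t s₂ U₂ n)
    (hL₃ : L₃ ≤ energyDensityTT' t s₃ U₃ n) :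
    a * L₁ + b * L₂ + c * L₃ ≤ energyDensityTT' t s U n := by
  rw [← hs, ← hU]
  exact energyDensityTT'_triangle_ge t hn0 hn2 hU₁ hU₂ hU₃ ha hb hc habc hL₁ hL₂ hL₃

/-! ### §3 Outward upper bounds along rays of the `(t', U)` half-plane -/

/-- **Extrapolated UPPER bound along a ray.** For anchors `p₁ = (s₁, U₁)`, `p₂ = (s₂, U₂)` in the
half-plane `U ≥ 0`, a certified LOWER bound `L₁ ≤ e(p₁)`, a certified UPPER bound `e(p₂) ≤ R₂`, and
`θ ≥ 0` such that `p₃ = p₂ + θ (p₂ - p₁)` still has `U ≥ 0`: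
`e(p₃) ≤ R₂ + θ (R₂ - L₁)` — `p₂` is the convex combination `(p₃ + θ p₁)/(1 + θ)` and `e` is jointly
concave. [cite: Israel1979, Thm. I.3.4] -/
theorem energyDensityTT'_le_extrapolate_line (t : ℝ) {n : ℝ} (hn0 : 0 ≤ n) (hn2 : n < 2)
    {s₁ U₁ s₂ U₂ θ L₁ R₂ : ℝ} (hU₁ : 0 ≤ U₁) (hθ : 0 ≤ θ)
    (hU₃ : 0 ≤ U₂ + θ * (U₂ - U₁)) (hL₁ : L₁ ≤ energyDensityTT' t s₁ U₁ n)
    (hR₂ : energyDensityTT' t s₂ U₂ n ≤ R₂) :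
    energyDensityTT' t (s₂ + θ * (s₂ - s₁)) (U₂ + θ * (U₂ - U₁)) n ≤ R₂ + θ * (R₂ - L₁) := by
  have h1θ : 0 < 1 + θ := by linarith
  set a : ℝ := 1 / (1 + θ) with ha'
  set b : ℝ := θ / (1 + θ) with hb'
  have ha : 0 ≤ a := div_nonneg zero_le_one h1θ.le
  have hb : 0 ≤ b := div_nonneg hθ h1θ.le
  have hab : a + b = 1 := by
    rw [ha', hb', ← add_div, div_eq_one_iff_eq h1θ.ne']
  have hp₃ : energyDensityTT' t (s₂ + θ * (s₂ - s₁)) (U₂ + θ * (U₂ - U₁)) n ≤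
      energyDensityTT' t (s₂ + θ * (s₂ - s₁)) (U₂ + θ * (U₂ - U₁)) n := le_rfl
  have h := energyDensityTT'_ge_convexComb t hn0 hn2 hU₃ hU₁ ha hb hab hp₃ hL₁
  have hs : a * (s₂ + θ * (s₂ - s₁)) + b * s₁ = s₂ := by
    rw [ha', hb']
    field_simp
    ring
  have hU : a * (U₂ + θ * (U₂ - U₁)) + b * U₁ = U₂ := by
    rw [ha', hb']
    field_simp
    ring
  rw [hs, hU] at h
  -- `a e(p₃) + b L₁ ≤ e(p₂) ≤ R₂`, multiply by `1 + θ`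
  have h' : a * energyDensityTT' t (s₂ + θ * (s₂ - s₁)) (U₂ + θ * (U₂ - U₁)) n + b * L₁ ≤ R₂ :=
    h.trans hR₂
  have hmul := mul_le_mul_of_nonneg_left h' h1θ.le
  have e1 : (1 + θ) * (a * energyDensityTT' t (s₂ + θ * (s₂ - s₁)) (U₂ + θ * (U₂ - U₁)) n +
      b * L₁) = energyDensityTT' t (s₂ + θ * (s₂ - s₁)) (U₂ + θ * (U₂ - U₁)) n + θ * L₁ := by
    rw [ha', hb']
    field_simp
  rw [e1] at hmul
  linarith

/-! ### §4 Lipschitz constants in `t'` and in `U` -/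

/-- **The free diagonal band costs at most `4|t'|` per particle** (finite volume): on the square
torus `(ℤ/Lℤ)²`, `L ≥ 3`, for every `N ≤ 2L²`, `-4|t'| N ≤ E_N(0, t', 0)` — Lieb–Loss' bound
`μN + 2 Σ_k min(ε(k) - μ, 0) ≤ E_N` at `μ = -4|t'|`, where every level
`ε(k) = -4t' cos p₁ cos p₂ ≥ -4|t'|` so the sum vanishes. [cite: LiebLoss1993, §8, Theorem 8.2] -/
theorem groundEnergy_hubbardTorusTT'_diag_ge {L : ℕ} [NeZero L] (hL : 3 ≤ L) (t' : ℝ) {N : ℕ}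
    (hN : N ≤ 2 * L ^ 2) : -(4 * |t'|) * N ≤ groundEnergy (hubbardTorusTT' L 0 t' 0) N := by
  have h := TTPrimeFree.le_groundEnergy_hubbardTorusTT' hL 0 t' le_rfl (-(4 * |t'|)) hN
  have hsum : ∑ k : Literature.Probability.LatticeModels.TorusSite 2 L,
      min (TTPrimeFree.ttBand L 0 t' k - -(4 * |t'|)) 0 = 0 := by
    refine Finset.sum_eq_zero fun k _ => min_eq_right ?_
    simp only [TTPrimeFree.ttBand, neg_zero, zero_mul, zero_add, sub_neg_eq_add]
    set c₀ := Real.cos (Literature.Probability.LatticeModels.latticeMomentum L k 0)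
    set c₁ := Real.cos (Literature.Probability.LatticeModels.latticeMomentum L k 1)
    have hc : |c₀ * c₁| ≤ 1 := by
      rw [abs_mul]
      exact mul_le_one₀ (Real.abs_cos_le_one _) (abs_nonneg _) (Real.abs_cos_le_one _)
    have h4 : |t' * (4 * c₀ * c₁)| ≤ 4 * |t'| := by
      rw [show t' * (4 * c₀ * c₁) = 4 * (t' * (c₀ * c₁)) by ring, abs_mul, abs_mul,
        abs_of_pos (by norm_num : (0 : ℝ) < 4)]
      nlinarith [abs_nonneg t']
    have := le_abs_self (t' * (4 * c₀ * c₁))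
    nlinarith
  rw [hsum, mul_zero, add_zero] at h
  exact h

/-- **The free diagonal band in the thermodynamic limit**: `-4|t'| n ≤ e(0, t', 0, n)` for
`0 ≤ n < 2`. [cite: LiebLoss1993, §8, Theorem 8.2] -/
theorem energyDensityTT'_diag_free_ge (t' : ℝ) {n : ℝ} (hn0 : 0 ≤ n) (hn2 : n < 2) :
    -(4 * |t'|) * n ≤ energyDensityTT' 0 t' 0 n := by
  refine energyDensityTT'_ge_of_eventually_ge_torus 0 t' le_rfl hn0 hn2 (μ := -(4 * |t'|)) ?_
  filter_upwards [eventually_ge_atTop 3] with L hL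
  haveI : NeZero L := ⟨by omega⟩
  have hN : rectN n L ≤ 2 * L ^ 2 := by
    have h := rectN_le_two_mul hn0 hn2.le L
    simpa [sq] using h
  have h := groundEnergy_hubbardTorusTT'_diag_ge hL t' hN
  have hL2 : (0 : ℝ) < (L : ℝ) ^ 2 := by positivity
  rw [le_div_iff₀ hL2]
  have e : (-(4 * |t'|) * n + -(4 * |t'|) * ((rectN n L : ℝ) / (L : ℝ) ^ 2 - n)) * (L : ℝ) ^ 2 =
      -(4 * |t'|) * (rectN n L : ℝ) := by
    field_simp
    ring
  rw [e]
  exact h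

/-- **Lipschitz continuity in `t'`, one-sided form**: for `U ≥ 0`, `0 ≤ n < 2` and all `s, s'`,
`e(t, s, U, n) - 4 n |s' - s| ≤ e(t, s', U, n)` (superadditivity `e(t,s',U) ≥ e(t,s,U) + e(0,s'-s,0)`
and the free diagonal band). A certified lower bound at `t' = s` is one at every `t'`, degraded
linearly; no second anchor is needed. [cite: Israel1979, Thm. I.3.4] -/
theorem energyDensityTT'_tPrime_lipschitz_ge (t : ℝ) {U : ℝ} (hU : 0 ≤ U) {n : ℝ} (hn0 : 0 ≤ n)
    (hn2 : n < 2) (s s' : ℝ) :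
    energyDensityTT' t s U n - 4 * n * |s' - s| ≤ energyDensityTT' t s' U n := by
  have h1 := energyDensityTT'_add_ge t 0 s (s' - s) hU le_rfl hn0 hn2
  have h2 := energyDensityTT'_diag_free_ge (s' - s) hn0 hn2
  rw [add_zero, add_sub_cancel, add_zero] at h1
  nlinarith

/-- **Lipschitz continuity in `t'`**: `|e(t, s, U, n) - e(t, s', U, n)| ≤ 4 n |s - s'|` (`U ≥ 0`,
`0 ≤ n < 2`). [cite: Israel1979, Thm. I.3.4] -/
theorem abs_energyDensityTT'_sub_tPrime_le (t : ℝ) {U : ℝ} (hU : 0 ≤ U) {n : ℝ} (hn0 : 0 ≤ n)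
    (hn2 : n < 2) (s s' : ℝ) :
    |energyDensityTT' t s U n - energyDensityTT' t s' U n| ≤ 4 * n * |s - s'| := by
  have h1 := energyDensityTT'_tPrime_lipschitz_ge t hU hn0 hn2 s s'
  have h2 := energyDensityTT'_tPrime_lipschitz_ge t hU hn0 hn2 s' s
  rw [abs_sub_comm s' s] at h1
  rw [abs_le]
  constructor <;> linarith

/-- From a certified LOWER bound at one `t'` to every `t'`: `L ≤ e(t, s, U, n)` gives
`L - 4 n |s' - s| ≤ e(t, s', U, n)`. [cite: Israel1979, Thm. I.3.4] -/
theorem energyDensityTT'_ge_of_lowerBound_tPrime (t : ℝ) {U : ℝ} (hU : 0 ≤ U) {n : ℝ}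
    (hn0 : 0 ≤ n) (hn2 : n < 2) {s s' L : ℝ} (hL : L ≤ energyDensityTT' t s U n) :
    L - 4 * n * |s' - s| ≤ energyDensityTT' t s' U n :=
  le_trans (by linarith) (energyDensityTT'_tPrime_lipschitz_ge t hU hn0 hn2 s s')

/-- From a certified UPPER bound at one `t'` to every `t'`: `e(t, s, U, n) ≤ R` gives
`e(t, s', U, n) ≤ R + 4 n |s' - s|`. [cite: Israel1979, Thm. I.3.4] -/
theorem energyDensityTT'_le_of_upperBound_tPrime (t : ℝ) {U : ℝ} (hU : 0 ≤ U) {n : ℝ}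
    (hn0 : 0 ≤ n) (hn2 : n < 2) {s s' R : ℝ} (hR : energyDensityTT' t s U n ≤ R) :
    energyDensityTT' t s' U n ≤ R + 4 * n * |s' - s| := by
  have h := energyDensityTT'_tPrime_lipschitz_ge t hU hn0 hn2 s' s
  rw [abs_sub_comm s s'] at h
  linarith

/-- **Lipschitz continuity in `U` (downward)**: for `0 ≤ U' ≤ U`, `0 ≤ n < 2`,
`e(t, s, U, n) - (U - U') (n/2)² ≤ e(t, s, U', n)` — concavity of `U ↦ e` on `[0, U]` (the chord
through `0` and `U` lies below `e` at `U'`) and the Hartree–Fock ceiling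
`e(U) ≤ e(0) + U (n/2)²`, i.e. the double-occupancy density of the interacting ground state never
exceeds the free value `(n/2)²`. [cite: BachLiebSolovej1994, eq. (2c.36)] [cite: KomaTasaki1994, §1] -/
theorem energyDensityTT'_ge_sub_mul_sq_U (t s : ℝ) {n : ℝ} (hn0 : 0 ≤ n) (hn2 : n < 2)
    {U U' : ℝ} (hU' : 0 ≤ U') (hle : U' ≤ U) :
    energyDensityTT' t s U n - (U - U') * (n / 2) ^ 2 ≤ energyDensityTT' t s U' n := by
  have hU : 0 ≤ U := hU'.trans hle
  have hHF := TTPrimeFree.energyDensityTT'_le_free_add_interaction t s hU hn0 hn2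
  rcases eq_or_lt_of_le hle with h | hlt
  · rw [h]; linarith
  rcases eq_or_lt_of_le hU' with h0 | hpos
  · rw [← h0]
    linarith
  -- `0 < U' < U`: the chord through `(0, e(0))` and `(U, e(U))` at `U'`
  have hch := energyDensityTT'_chord_le t s hn0 hn2 (U₁ := 0) (U := U') (U₂ := U) le_rfl hpos hlt
    le_rfl le_rfl
  have hUpos : 0 < U := hpos.trans hlt
  rw [sub_zero, sub_zero, div_le_iff₀ hUpos] at hch
  -- replace `e(0)` by its lower bound `e(U) - U (n/2)^2`
  have h0 : energyDensityTT' t s U n - U * (n / 2) ^ 2 ≤ energyDensityTT' t s 0 n := by linarith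
  have h1 : (U - U') * (energyDensityTT' t s U n - U * (n / 2) ^ 2) ≤
      (U - U') * energyDensityTT' t s 0 n := mul_le_mul_of_nonneg_left h0 (by linarith)
  nlinarith

/-- **Lipschitz continuity in `U`**: for `U, U' ≥ 0`, `0 ≤ n < 2`,
`|e(t, s, U, n) - e(t, s, U', n)| ≤ |U - U'| (n/2)²` (downward: `energyDensityTT'_ge_sub_mul_sq_U`;
upward the difference is even `≥ 0`, the tree's `energyDensityTT'_mono_U`).
[cite: BachLiebSolovej1994, eq. (2c.36)] [cite: KomaTasaki1994, §1] -/
theorem abs_energyDensityTT'_sub_U_le (t s : ℝ) {n : ℝ} (hn0 : 0 ≤ n) (hn2 : n < 2)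
    {U U' : ℝ} (hU : 0 ≤ U) (hU' : 0 ≤ U') :
    |energyDensityTT' t s U n - energyDensityTT' t s U' n| ≤ |U - U'| * (n / 2) ^ 2 := by
  have hmono : ∀ {V W : ℝ}, 0 ≤ V → V ≤ W →
      energyDensityTT' t s V n ≤ energyDensityTT' t s W n :=
    fun hV hVW => energyDensityTT'_mono_U t s hn0 hn2 hV hVW
  rcases le_total U' U with hle | hle
  · have h1 := energyDensityTT'_ge_sub_mul_sq_U t s hn0 hn2 hU' hle
    have h2 := hmono hU' hle
    rw [abs_of_nonneg (by linarith : 0 ≤ energyDensityTT' t s U n - energyDensityTT' t s U' n),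
      abs_of_nonneg (by linarith : 0 ≤ U - U')]
    linarith
  · have h1 := energyDensityTT'_ge_sub_mul_sq_U t s hn0 hn2 hU hle
    have h2 := hmono hU hle
    rw [abs_of_nonpos (by linarith : energyDensityTT' t s U n - energyDensityTT' t s U' n ≤ 0),
      abs_of_nonpos (by linarith : U - U' ≤ 0)]
    linarith

/-! ### §5 Outward lower bounds in the density -/

/-- **Extrapolated LOWER bound in the density, to the right.** For `0 ≤ n₀ < n₁ < n < 2`, `U ≥ 0`,
a certified UPPER bound `e(t,s,U,n₀) ≤ R₀` and a certified LOWER bound `L₁ ≤ e(t,s,U,n₁)`: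
`L₁ + (L₁ - R₀)(n - n₁)/(n₁ - n₀) ≤ e(t,s,U,n)` (convexity in the density: the chord through
`n₀, n₁` extended beyond `n₁` lies below `e`). [cite: Ruelle1969, §3.3] -/
theorem energyDensityTT'_ge_density_extrapolate_right (t s : ℝ) {U : ℝ} (hU : 0 ≤ U)
    {n₀ n₁ n R₀ L₁ : ℝ} (hn₀ : 0 ≤ n₀) (h₀₁ : n₀ < n₁) (h₁ : n₁ < n) (hn : n < 2)
    (hR₀ : energyDensityTT' t s U n₀ ≤ R₀) (hL₁ : L₁ ≤ energyDensityTT' t s U n₁) :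
    L₁ + (L₁ - R₀) * (n - n₁) / (n₁ - n₀) ≤ energyDensityTT' t s U n := by
  -- `n₁` is an interior point of `[n₀, n]`: `e(n₁) ≤ chord(n₀, n)(n₁)`
  have hch := energyDensityTT'_le_density_chord t s hU (n₁ := n₀) (n := n₁) (n₂ := n) hn₀ h₀₁ h₁ hn
    hR₀ le_rfl
  have hd : 0 < n - n₀ := by linarith
  have hd' : 0 < n₁ - n₀ := by linarith
  rw [le_div_iff₀ hd] at hch
  have hL := mul_le_mul_of_nonneg_right hL₁ hd.le
  have key : L₁ * (n₁ - n₀) + (L₁ - R₀) * (n - n₁) ≤ energyDensityTT' t s U n * (n₁ - n₀) := by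
    nlinarith [hch, hL]
  have e : L₁ + (L₁ - R₀) * (n - n₁) / (n₁ - n₀) =
      (L₁ * (n₁ - n₀) + (L₁ - R₀) * (n - n₁)) / (n₁ - n₀) := by
    field_simp
  rw [e, div_le_iff₀ hd']
  exact key

/-- **Extrapolated LOWER bound in the density, to the left.** For `0 ≤ n < n₁ < n₀ < 2`, `U ≥ 0`,
a certified UPPER bound `e(t,s,U,n₀) ≤ R₀` and a certified LOWER bound `L₁ ≤ e(t,s,U,n₁)`:
`L₁ + (L₁ - R₀)(n₁ - n)/(n₀ - n₁) ≤ e(t,s,U,n)`. [cite: Ruelle1969, §3.3] -/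
theorem energyDensityTT'_ge_density_extrapolate_left (t s : ℝ) {U : ℝ} (hU : 0 ≤ U)
    {n₀ n₁ n R₀ L₁ : ℝ} (hn : 0 ≤ n) (h₁ : n < n₁) (h₀₁ : n₁ < n₀) (hn₀ : n₀ < 2)
    (hR₀ : energyDensityTT' t s U n₀ ≤ R₀) (hL₁ : L₁ ≤ energyDensityTT' t s U n₁) :
    L₁ + (L₁ - R₀) * (n₁ - n) / (n₀ - n₁) ≤ energyDensityTT' t s U n := by
  -- `n₁` is an interior point of `[n, n₀]`
  have hch := energyDensityTT'_le_density_chord t s hU (n₁ := n) (n := n₁) (n₂ := n₀) hn h₁ h₀₁ hn₀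
    le_rfl hR₀
  have hd : 0 < n₀ - n := by linarith
  have hd' : 0 < n₀ - n₁ := by linarith
  rw [le_div_iff₀ hd] at hch
  have hL := mul_le_mul_of_nonneg_right hL₁ hd.le
  have key : L₁ * (n₀ - n₁) + (L₁ - R₀) * (n₁ - n) ≤ energyDensityTT' t s U n * (n₀ - n₁) := by
    nlinarith [hch, hL]
  have e : L₁ + (L₁ - R₀) * (n₁ - n) / (n₀ - n₁) =
      (L₁ * (n₀ - n₁) + (L₁ - R₀) * (n₁ - n)) / (n₀ - n₁) := by
    field_simp
  rw [e, div_le_iff₀ hd']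
  exact key

/-! ### §6 Homogeneity in the coupling vector (the unit of energy) -/

/-- `⟨ψ, (c • A)ψ⟩ = c ⟨ψ, Aψ⟩`. [folklore] -/
private theorem expect_smul' {ι : Type*} [Fintype ι] (c : ℂ) (A : Matrix (Finset ι) (Finset ι) ℂ)
    (ψ : Fock ι) : expect (c • A) ψ = c * expect A ψ := by
  simp [expect, smul_mulVec, dotProduct_smul]

/-- `H(ct, ct', cU) = c • H(t, t', U)`: rescaling all couplings rescales the Hamiltonian.
[cite: LeBlancEtAl2015, eq. (1)] -/
theorem hubbardRectTorusTT'_smul (a b : ℕ) (c t t' U : ℝ) :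
    hubbardRectTorusTT' a b (c * t) (c * t') (c * U) = (c : ℂ) • hubbardRectTorusTT' a b t t' U := by
  have h := hubbardRectTorusTT'_convexComb a b c 0 t t t' t' U U
  simp only [zero_mul, add_zero, Complex.ofReal_zero, zero_smul] at h
  exact h

open scoped Pointwise in
/-- **Positive homogeneity of the sector ground-state energies** (finite volume): for `c ≥ 0`,
`E_N(ct, ct', cU) = c · E_N(t, t', U)` — the Rayleigh quotients of `c • H` are `c` times those of
`H`, and `sInf (c • S) = c · sInf S`. [cite: KomaTasaki1994, §1] -/
theorem groundEnergy_hubbardRectTorusTT'_smul (a b N : ℕ) {c : ℝ} (hc : 0 ≤ c) (t t' U : ℝ) :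
    groundEnergy (hubbardRectTorusTT' a b (c * t) (c * t') (c * U)) N =
      c * groundEnergy (hubbardRectTorusTT' a b t t' U) N := by
  rw [hubbardRectTorusTT'_smul]
  unfold groundEnergy
  have hset : {E : ℝ | ∃ ψ : Fock (Orb (Fin a ×ₗ Fin b)), IsNParticle N ψ ∧ star ψ ⬝ᵥ ψ = 1 ∧
        E = (expect ((c : ℂ) • hubbardRectTorusTT' a b t t' U) ψ).re} =
      c • {E : ℝ | ∃ ψ : Fock (Orb (Fin a ×ₗ Fin b)), IsNParticle N ψ ∧ star ψ ⬝ᵥ ψ = 1 ∧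
        E = (expect (hubbardRectTorusTT' a b t t' U) ψ).re} := by
    ext E
    simp only [Set.mem_setOf_eq, Set.mem_smul_set, smul_eq_mul]
    constructor
    · rintro ⟨ψ, hN, h1, rfl⟩
      exact ⟨_, ⟨ψ, hN, h1, rfl⟩, by rw [expect_smul', Complex.re_ofReal_mul]⟩
    · rintro ⟨E', ⟨ψ, hN, h1, rfl⟩, rfl⟩
      exact ⟨ψ, hN, h1, by rw [expect_smul', Complex.re_ofReal_mul]⟩
  rw [hset, Real.sInf_smul_of_nonneg hc, smul_eq_mul]

/-- **Positive homogeneity of the energy density**: for `c ≥ 0`, `U ≥ 0`, `0 ≤ n < 2`,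
`e(ct, ct', cU, n) = c · e(t, t', U, n)` (so `t ≡ 1` is no loss: `e(t,t',U,n) = t·e(1, t'/t, U/t, n)`
for `t > 0`). [cite: Ruelle1969, §3.3] -/
theorem energyDensityTT'_smul (t t' : ℝ) {U : ℝ} (hU : 0 ≤ U) {n : ℝ} (hn0 : 0 ≤ n) (hn2 : n < 2)
    {c : ℝ} (hc : 0 ≤ c) :
    energyDensityTT' (c * t) (c * t') (c * U) n = c * energyDensityTT' t t' U n := by
  have l1 := tendsto_energyDensityTT' (c * t) (c * t') (mul_nonneg hc hU) hn0 hn2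
  have l2 := (tendsto_energyDensityTT' t t' hU hn0 hn2).const_mul c
  refine tendsto_nhds_unique l1 (l2.congr fun L => ?_)
  rw [groundEnergy_hubbardRectTorusTT'_smul L L (rectN n L) hc, mul_div_assoc]

/-- **The unit of energy**: for `t > 0`, `e(t, t', U, n) = t · e(1, t'/t, U/t, n)` (`U ≥ 0`,
`0 ≤ n < 2`) — certified tables at `t = 1` cover every `t > 0`. [cite: Ruelle1969, §3.3] -/
theorem energyDensityTT'_eq_mul_unit {t : ℝ} (ht : 0 < t) (t' : ℝ) {U : ℝ} (hU : 0 ≤ U) {n : ℝ}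
    (hn0 : 0 ≤ n) (hn2 : n < 2) :
    energyDensityTT' t t' U n = t * energyDensityTT' 1 (t' / t) (U / t) n := by
  have h := energyDensityTT'_smul 1 (t' / t) (div_nonneg hU ht.le) hn0 hn2 ht.le
  rw [mul_one, mul_div_cancel₀ _ ht.ne', mul_div_cancel₀ _ ht.ne'] at h
  exact h

end ThermodynamicLimit

end Literature.MathematicalPhysics.QuantumLattice

end
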